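import Mathlib
import HarnessLib
import Summits.Langlands.Langlands.Theses.SkinnerWilesDefectOne
import Summits.Langlands.Langlands.Theorems.ReducibleOrdinaryProModular.Negative.LevelAndRamification
import Literature.NumberTheory.GaloisRepresentations.NearlyOrdinaryDeformationRing
import Literature.NumberTheory.Automorphic.POrdinaryHeckeAlgebraGL2
import Summits.Langlands.Langlands.Theorems.SkinnerWilesDefectOneReducibleOrdinaryProModularTypeDSetup
import Summits.Langlands.Langlands.Theorems.SkinnerWilesDefectOneReducibleOrdinaryProModularGenericEisensteinDefs
import Summits.Langlands.Langlands.Theorems.SkinnerWilesDefectOneReducibleOrdinaryProModularRigidityCriterionAux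
import Summits.Langlands.Langlands.Theorems.SkinnerWilesDefectOneReducibleOrdinaryProModularGenericEisensteinRedIdealAux

/-!
# Line `generic-eisenstein-rigidity` — LEAD SKELETON v8 for `ReducibleOrdinaryProModular`
# (stmt-Langlands-12919, route SkinnerWilesDefectOne, rank 2 — the ENGINE)

v3 = the planner's checked skeleton v2 (planner-cruxplan-stmt-Langlands-12919-generic-eisenstein-r-0, tree
`Cruxes/ReducibleOrdinaryProModular/Lines/generic_eisenstein_rigidity.lean`, commit c8dd6052db2d) taken over UNCHANGED IN
ITS FOUR REGISTERED STUB SIGNATURES by the line lead prover-line-stmt-Langlands-12919-c2-0 (continuation lead c2 of lineage 0,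
2026-08-16, after filing `Lines/steinberg-hyperplane-dead.md` for the inherited line and PICKED.md for this one).  Lead notes:
* S1 `stub_typeDSetup` is closable from the LANDED stub `SteinbergHyperplane.stub_orientedLocalDatum` (p91095: oriented
  Skinner–Wiles datum over `𝒪_E` with a local integral specialisation, any `v₀`) and
  `SteinbergHyperplane.ModelData.Models.ker_notMem_reducibleLocus` (p92146); wave 1 lands it as
  `Theorems/SkinnerWilesDefectOneReducibleOrdinaryProModularTypeDSetup.lean`, after which this file imports it by name.
  v4 (2026-08-16, lead c2): S1 LANDED (p100166 ACCEPTED, commit c6e890c757d1) — its sorried copy is removed below, the file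
  imports `…TypeDSetup` and `ReducibleOrdinaryProModular_of` uses `stub_typeDSetup` BY NAME; three registered stubs remain.
* RESHAPE v5 (2026-08-16, lead c2, after wave 1: stub-worker verdict `stub-misstated` on S4): as registered in v2–v4,
  S4 was FALSE whenever its hypotheses are satisfiable, because the Hecke datum `H : POrdinaryHeckeAlgebraGL2 F p 𝒟.S Λ`
  with FREE `Λ` admits INERT JUNK: from any instance `(H, θ, P, …)` of the hypotheses put `T' := H.T[y]/(yⁿ − a₀)` with
  `a₀ ∈ redIdeal D_T ∩ P` a ℤ-polynomial in traces and determinants whose `R`-avatar `s` lies outside `𝔮`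
  (`𝔮 ∉ V(I)` as `𝔭 ∉ V(I)`), `Λ' := T'`, `D' := D_T ⊗ T'`, `θ' := θ ⊔ (y ↦ 0)`, `P' := (P, y)`: every field of the
  structure (`moduleFinite`, `dense_adjoin` are relative to `Λ' = T'`, hence vacuous) and every hypothesis survives
  (`J' = J T'` by Hensel descent of the two characters — residually distinct —, lengths multiply by `n`, the regular
  element stays regular by freeness), while an admissible `ϑ' : T' → R/𝔮` would give `ϑ'(y)ⁿ = s mod 𝔮`, a FIXED non-zero
  non-unit of the Noetherian local domain `R/𝔮`, impossible for `n ≫ 0` (Krull).  Hence S2 ∧ S3 ∧ S4 (v2) was contradictory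
  on every `𝓡` with an irreducible prime.  Repair = Skinner–Wiles' Lemma 3.11 made explicit: S3 now EXPORTS and S4 ASSUMES
  (i) an `𝒪`-algebra structure on `H.T`, (ii) TRACE-DENSITY OVER `𝒪` — `T` is topologically generated over `𝒪` by traces,
  determinants and the ordinary characters (true for the intended `𝕋^{ord}_𝔪`: the diamond operators are themselves such
  values) —, (iii) `θ` is `𝒪`-compatible.  The junk `T'` fails (ii) (`y` is not in the closure of the image of `T`).  The
  corrected S4 remains blocked on (R1); see the lead's NOTES.  Composition unchanged but for threading (i)–(iii).
* v6 (lead c2): five helper sub-goals of wave 1 registered (section before the composition) so the worker files land as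
  `--supports`; the three real stubs S2–S4 are unchanged from v5.
* v7 (lead c2): `redIdeal` and its certificate `redIdeal_le` LANDED in `…GenericEisensteinDefs` (p106218) and the S4 helper
  `…RigidityCriterionAux` LANDED (p105711) — both imported, local copies removed; `…GenericEisensteinRedIdealAux` LANDED (p111272, to be
  imported once built); `…GenericEisensteinReducibleLocusAux` in flight.
* v8 (lead c2, final of this seat): all five helper sub-goals LANDED (p105711 p106218 p111272 p112399); Defs, criterion and
  Bellaïche–Chenevier helpers imported, registration copies removed; the three REAL stubs S2–S4 remain `sorry` — see
  `Lines/generic-eisenstein-rigidity-dead.md` for the line verdict.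
* S2–S4 keep the planner's statements; S3 (hardest) is held by the lead, S2/S4 are waved.
* The only local definition `redIdeal` must move to a reviewed Defs file before any of S2–S4 can land under `Theorems/`.

Crux (FIXED, the route's decl):
`Summit.Langlands.Langlands.Theses.SkinnerWilesDefectOne.ReducibleOrdinaryProModular`.

THE LINE (crux idea `generic-eisenstein-rigidity`, ideator 1; triage r1-1/2/3 all pass).  Skinner–Wiles
prove "every component of `Spec R_𝒟` is pro-modular" from two properties of the nearly ordinary
deformation ring `R_𝒟` of the residual extension: (P1) a NICE prime (dimension one, irreducible,
pro-modular) makes every minimal prime below it pro-modular — Taylor–Wiles patching at the nice prime —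
and (P2) nice primes exist on enough components — Raynaud connectivity with margin two (SW99 §4.2,
Prop. 4.1, Prop. 8.4).  At Taylor–Wiles defect `l₀ = 1` (imaginary quadratic `F`) both break: (P1) is one
Taylor–Wiles prime short and (P2) has margin one.  This line replaces the nice prime by the GENERIC POINT
`η` OF AN EISENSTEIN DIVISOR of the component: a prime `η` of the reducible locus `Z^red = V(I)`
(`I` = reducibility ideal) which is minimal over `I` and lies on the component.  There everything is as
rigid as in Berger–Klosin's unique-deformation setting, but GENERICALLY instead of residually:
`(R/I)_η` is Artinian (automatic), `I·R_η` is principal (generic lower-left Selmer rank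
`1 = r₂(F) = l₀`, off the tame Euler divisors), and the Berger–Klosin / Wiles–Lenstra numerical criterion
"`length (T_P / J T_P) ≥ length (R_η / I R_η)`" (`J` = reducibility = Eisenstein ideal of the CUSPIDAL
ordinary Hecke determinant, `P` the Hecke prime under `η`) forces `R̂_η ≅ T̂_P`, whence the minimal
primes below `η` are pro-modular — with NO Taylor–Wiles primes and NO Raynaud chaining.  The one admissible
`ρ` of the crux sits on such a component (it is an irreducible prime `𝔭 ⊇ 𝔮`), so `𝔭` is pro-modular
(SW §4.1: pro-modularity ascends) and the attached Hecke datum makes `ρ` a continuous point of the big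
Hecke algebra `𝕋(𝒰')` for a tame level with enlarged bad set (landed Negative lemma: the level is never
the full one).

SKELETON (4 registered stubs + the PROVED exit `heckeExit` + the composition
`ReducibleOrdinaryProModular_of`):
* `stub_typeDSetup`                    — SW §2 / CM §2 set-up: the crux's `(ρ, ρ₀, orientation)` is an
                                          irreducible prime `𝔭` of a nearly ordinary deformation ring
                                          `R_𝒟` of an SW-admissible ORIENTED datum `𝒟` ([SW] clause), with
                                          an integral local specialisation `f : R_𝒟 → ℚ̄_p`, `ker f = 𝔭`.
* `stub_eisensteinDivisor`             — C1 + C2 (Galois geometry of `Z^red`, margin one): a component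
                                          `𝔮 ⊆ 𝔭` carries a generic point `η` of `Z^red` with `I·R_η`
                                          principal.
* `stub_cuspidalEisensteinCongruence`  — C3 (HARDEST; Hecke side): at an Eisenstein divisor `η` of the
                                          component there is a CUSPIDAL oriented nearly ordinary Hecke
                                          datum `H` ATTACHED to some `𝕋(𝒰)`, a local surjective
                                          `θ : T → R/η` carrying `D_T` to `D_R mod η` (the Eisenstein
                                          congruence EXISTS generically along the sheet), a non-zero-divisor
                                          in `J·T_P` (cuspidality) and the depth inequality
                                          `length(T_P/J T_P) ≥ length(R_η/I R_η)` (finite).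
* `stub_rigidityAtGenericPoint`        — (P1_η): representability of `R̂_η` + the BK criterion in
                                          regular-element form ⇒ `𝔮` is (locally) pro-modular.
* `heckeExit` (PROVED, no `sorry`)    — attached `H`, `ker f ⊇ 𝔮` locally pro-modular, `ρ ≅ f ∘ ρ_𝒟`,
                                          `ρ` a.e. unramified ⇒ `∃ 𝒰'`, `𝒰'.IsPadicallyAutomorphic ρ`
                                          (continuity of the point from locality + integrality, Frobenius
                                          polynomials through the determinant identity, bad set enlarged
                                          by the ramification of `ρ`).
Recurring clauses, written INLINE in the signatures (tree / Mathlib declarations only; the one local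
definition is the data-valued `redIdeal`, the Bellaïche–Chenevier reducibility ideal of a `PseudoRep2`):
[SW] the SW-admissibility conjunction on `𝒟` — `F` imaginary quadratic, `p ≠ 2`, `𝒪` a domain of
characteristic `0`, `𝒟.HasScalarCentralizer` (the residual extension is NON-SPLIT, BergerKlosin2012
Lemma 28), `𝒟.IsDistinguishedAt v` at `v ∣ p`, `𝒟.residual` upper triangular in the standard basis
(`e₁` = global sub-line, character `χ̄₁`), and the ORIENTATION = transversality `(𝒟.frame v)₁₀ ≠ 0`
(the residual special line at `v ∣ p` is not the global sub-line, i.e. it is the `χ̄₂|_{D_v}`-eigenline: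
SW's type-`𝒟` condition `ψ₁ ≡ χ`, the crux's `‖Q₀₀‖ ≤ ‖Q₁₀‖`; with upper-triangularity `ρ̄|_{D_v}`
splits — SW's admissible class); [ATT] attachment of `H` to `𝒰` through `ι : 𝕋(𝒰) → T` — `ι`
continuous and, at `v ∉ 𝒰.bad`, `D_T` unramified with Frobenius polynomial `ι(X² − T_{v,1}X + q_vT_{v,2})`
(arithmetic Frobenius, the tree's `IsAssociated` convention); [LPM q] local pro-modularity of an ideal
`q ⊆ R_𝒟` — SW (4.1) with the locality SW get for free, see `isLocallyProModular_of_le` (implies the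
tree's `IsProModularPrime`, the `example` after it); [ORP] oriented points of `H` — every continuous
`ℚ̄_p`-point of `T` with irreducible Galois representation of residual type `(χ̄₁, χ̄₂)` (ordered as in
`𝒟`) is nearly ordinary at every `v ∣ p` in a frame `Q` with `‖Q₀₀‖ ≤ ‖Q₁₀‖` (SW99 (3.2)/(3.4)(vi), the
crux's orientation clause with the weight dropped).

Disproof used (Cruxes/ReducibleOrdinaryProModular/Disproof.lean, cdisprove v2, verdict NO KILL; landed
`Theorems/ReducibleOrdinaryProModular/Negative/LevelAndRamification.lean`, imported here):
`crux_of_proModularity` — `p ≠ 2`, pinned `O`, integral model, `IsPDistinguishedAt`, orientation,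
ordinarity, `k ≥ 2` are METHOD hypotheses: they are consumed by `stub_typeDSetup` (they make `ρ` a type-`𝒟`
point: orientation = transversality of the n.o. line = the last conjunct of [SW], distinguishedness =
`𝒟.IsDistinguishedAt`, integral model = the residual extension `𝒟.residual`) and by [ORP];
the weight `(k, m)` is used only through near-ordinarity (pro-modularity needs no classical weight — the
exit crux 12921 owns classicality).  `withoutAEUnramified_iff` / `ae_isUnramifiedAt_of_isPadicallyAutomorphic`
— `hunr` is NECESSARY: the line uses it exactly once, in the proved `heckeExit` (the bad set of `𝒰'` must contain
the finitely many ramified places).  `not_isPadicallyAutomorphic_full` / `exists_isPadicallyAutomorphic_bad_eq`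
(§§3, 7) — the exit concludes at a tame level with ENLARGED bad set, never at `TameLevel.full`.  §5
orientation lemmas — the transversality clause `(𝒟.frame v)₁₀ ≠ 0` is their residual shadow.  No
`_false_without_H` theorem, no Targets, no stub kills, no Negative lemma refuting any stub exist (§Targets
empty); `ledger negatives --problem Langlands`: one unrelated item (stmt-Langlands-3797).
-/

set_option linter.dupNamespace false
set_option linter.unusedVariables false

namespace Summit.Langlands.Langlands.Cruxes.ReducibleOrdinaryProModular.GenericEisensteinRigidity

open Summit.Langlands.Langlands.Theses.SkinnerWilesDefectOne
open Literature.NumberTheory.Automorphic Literature.NumberTheory.Automorphic.BigHeckeGLn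
open Literature.NumberTheory.GaloisRepresentations
open NumberField IsDedekindDomain IsLocalRing Filter Field
open scoped MatrixGroups Matrix NumberField NNReal

noncomputable section

/-! ## Local vocabulary (transparent; every notion unfolds to tree / Mathlib declarations) -/

/-! `redIdeal` LANDED in the vocabulary file `…GenericEisensteinDefs` (imported). -/

/-- **Local pro-modularity ascends** along `q ≤ q'` ("if `q` is pro-modular and `p ⊇ q` then `p` is
pro-modular", SW99 §4.1), locality being preserved.  Local pro-modularity of an ideal `q` of `R_𝒟` for
the Hecke datum `H` (the shape used VERBATIM in `stub_rigidityAtGenericPoint`'s conclusion and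
`heckeExit`'s hypothesis) is Skinner–Wiles' (4.1) — a ring homomorphism `ϑ : T → R_𝒟/q` carrying
the Hecke determinant to `det ρ_𝒟 mod q` — together with the LOCALITY `ϑ(𝔪_T) ⊆ 𝔪_R·(R/q)` that SW get
for free from `𝒪`-algebra maps of complete local rings (hence adic continuity); dropping the locality
conjunct gives the tree's `POrdinaryHeckeAlgebraGL2.IsProModularPrime` on the nose.
[cite: SkinnerWiles1999, §4.1 (4.1)] -/
theorem isLocallyProModular_of_le {F : Type} [Field F] [NumberField F] {p : ℕ}
    [Fact p.Prime] {S : Set (HeightOneSpectrum (𝓞 F))} {Λ : Type} [CommRing Λ] [TopologicalSpace Λ]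
    (H : POrdinaryHeckeAlgebraGL2 F p S Λ) {𝒪 : Type} [CommRing 𝒪] {k : Type} [Field k]
    [Algebra 𝒪 k] {𝒟 : NearlyOrdinaryDatum F p 𝒪 k} (𝓡 : NearlyOrdinaryDeformationRing.{0} 𝒟)
    {q q' : Ideal 𝓡.R}
    (h : ∃ ϑ : H.T →+* 𝓡.R ⧸ q,
      (maximalIdeal H.T).map ϑ ≤ (maximalIdeal 𝓡.R).map (Ideal.Quotient.mk q) ∧
        H.galoisRep.map ϑ = (PseudoRep2.ofRep 𝓡.ρ).map (Ideal.Quotient.mk q))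
    (hle : q ≤ q') :
    ∃ ϑ : H.T →+* 𝓡.R ⧸ q',
      (maximalIdeal H.T).map ϑ ≤ (maximalIdeal 𝓡.R).map (Ideal.Quotient.mk q') ∧
        H.galoisRep.map ϑ = (PseudoRep2.ofRep 𝓡.ρ).map (Ideal.Quotient.mk q') := by
  obtain ⟨θ, hloc, hθ⟩ := h
  refine ⟨(Ideal.Quotient.factor hle).comp θ, ?_, ?_⟩
  · rw [← Ideal.map_map]
    refine (Ideal.map_mono hloc).trans ?_
    rw [Ideal.map_map, Ideal.Quotient.factor_comp_mk]
  · rw [← PseudoRep2.map_map, hθ, PseudoRep2.map_map, Ideal.Quotient.factor_comp_mk]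

/-- The tree's pro-modularity `IsProModularPrime` is the local notion with locality forgotten (anchor to the
tree vocabulary; `IsNicePrime` takes such a predicate). [folklore] -/
example {F : Type} [Field F] [NumberField F] {p : ℕ}
    [Fact p.Prime] {S : Set (HeightOneSpectrum (𝓞 F))} {Λ : Type} [CommRing Λ] [TopologicalSpace Λ]
    (H : POrdinaryHeckeAlgebraGL2 F p S Λ) {𝒪 : Type} [CommRing 𝒪] {k : Type} [Field k]
    [Algebra 𝒪 k] {𝒟 : NearlyOrdinaryDatum F p 𝒪 k} (𝓡 : NearlyOrdinaryDeformationRing.{0} 𝒟)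
    {q : Ideal 𝓡.R}
    (h : ∃ ϑ : H.T →+* 𝓡.R ⧸ q,
      (maximalIdeal H.T).map ϑ ≤ (maximalIdeal 𝓡.R).map (Ideal.Quotient.mk q) ∧
        H.galoisRep.map ϑ = (PseudoRep2.ofRep 𝓡.ρ).map (Ideal.Quotient.mk q)) :
    H.IsProModularPrime (PseudoRep2.ofRep 𝓡.ρ) q := by
  obtain ⟨θ, -, hθ⟩ := h
  exact ⟨θ, hθ⟩

/-! ## The registered stubs -/

/-! S1 `stub_typeDSetup` LANDED (p100166, `Theorems/SkinnerWilesDefectOneReducibleOrdinaryProModularTypeDSetup.lean`) — imported and used by name. -/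

/-- **stub_eisensteinDivisor (C1 + C2: an Eisenstein divisor with generic principality on the component
of an irreducible point; size L).**  For an SW-admissible oriented datum over an imaginary quadratic `F`
and any prime `𝔭` of `R_𝒟` outside the reducible locus: some minimal prime `𝔮 ⊆ 𝔭` (a component `C`
through `𝔭`) lies below a prime `η` of the reducible locus which is MINIMAL over the reducibility ideal
`I = redIdeal (det ρ_𝒟)` (the generic point of an irreducible component — a "sheet" — of
`Z^red = V(I)`; so `(R/I)_η` is Artinian) and at which `I·R_η` is PRINCIPAL.  Mechanism: (C1) the
components of `Spec R_𝒟` have dimension `≥ dim Λ_F − l₀ = 4` (Galois-cohomological presentation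
`h¹_𝒟 − h¹_{𝒟⊥} = 3` over the 1-dimensional `𝒪`; local Borel rings CM where the residual ratio is
`ω^{±1}`, triage X2) while `Z^red` is the cone over `ℙ(H)` of SW99 Lemma 2.7 transposed to `δ_F = 2`:
`dim Z^red = 2 + max_Z (dim Z + r_Z − 1) ≤ 3` when the split (fine) `χ`-Selmer module `H` over
`Λ₁ = 𝒪⟦ℤ_p²⟧` is torsion with no common divisor of the primitive Katz pair, `μ = 0` and `r₀ ≤ 2`
(card fine-selmer-codimension-two; Gillard/Hida `μ = 0` at split `p`; r1-1 job j007870: `r₀ = 1` for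
20/21 headline fields, r1-3 job j009536: `r_S = 1` for the witness `ℚ(√−2), p = 5`); `C ∩ Z^red ∋ 𝔪` is
non-empty and, `I` restricted to `C` being generated up to radical by `h_ll = h¹(G_{F,S}, k(χ̄₂/χ̄₁))`
elements, has codimension `≤ h_ll` in `C` — codimension ONE, i.e. `C` contains a whole sheet, when
`h_ll = 1` (Berger–Klosin shape) and, for `h_ll ≥ 2`, whenever the margin-one count is sharp; (C2) at the
generic point of a characteristic-0 sheet `W(Ψ₀)` the conormal module `I_η/I_η²` is the generic
lower-left Selmer group `H¹(G_{F,S}, K(Ψ₀⁻¹))` of rank `1 + h² = 1 = r₂(F)` off the tame Euler divisors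
`D_w = {Ψ(Frob_w) = N w}` (Greenberg–Wiles Euler characteristic; triage (F5)), so `I_η` is principal by
Nakayama.  Why it might fail: for `h_ll ≥ 2` (the whole headline `χ̄ = ω` population, `h_ll = #S_f ≥ 2`)
the component through `𝔭` may meet `Z^red` only in codimension 2; every sheet of `C` may sit on a tame
Euler divisor `D_w` (forced congruence `χ̄(Frob_w) N w ≡ 1` at tamely ramified `w`), where `I_η` needs two
generators; a 4-dimensional `μ`- or common-divisor component of `Z^red` (GGC-type pseudo-nullity is open).
[cite: SkinnerWiles1999, §2.2 Lemmas 2.7–2.8 and Prop. 2.4] [cite: BergerKlosin2012, §5.2]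
[cite: CalegariMazur2008, §1] -/
theorem stub_eisensteinDivisor : ∀ (F : Type) [Field F] [NumberField F] (p : ℕ) [Fact p.Prime]
    (𝒪 : Type) [CommRing 𝒪] [IsLocalRing 𝒪] [IsNoetherianRing 𝒪] [IsAdicComplete (maximalIdeal 𝒪) 𝒪]
    (k : Type) [Field k] [Finite k] [CharP k p] [Algebra 𝒪 k]
    (𝒟 : NearlyOrdinaryDatum F p 𝒪 k) (𝓡 : NearlyOrdinaryDeformationRing.{0} 𝒟),
    (IsTotallyComplex F ∧ Module.finrank ℚ F = 2 ∧ p ≠ 2 ∧ IsDomain 𝒪 ∧ CharZero 𝒪 ∧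
      𝒟.HasScalarCentralizer ∧
      (∀ v : HeightOneSpectrum (𝓞 F), (p : 𝓞 F) ∈ v.asIdeal → 𝒟.IsDistinguishedAt v) ∧
      (∀ γ, (𝒟.residual γ).val 1 0 = 0) ∧
      (∀ v : HeightOneSpectrum (𝓞 F), (p : 𝓞 F) ∈ v.asIdeal → (𝒟.frame v).val 1 0 ≠ 0)) →
    ∀ 𝔭 : PrimeSpectrum 𝓡.R, 𝔭 ∉ 𝓡.reducibleLocus →
    ∃ 𝔮 ∈ minimalPrimes 𝓡.R, 𝔮 ≤ 𝔭.asIdeal ∧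
      ∃ η : PrimeSpectrum 𝓡.R, η ∈ 𝓡.reducibleLocus ∧ 𝔮 ≤ η.asIdeal ∧
        η.asIdeal ∈ (redIdeal (PseudoRep2.ofRep 𝓡.ρ)).minimalPrimes ∧
        (Ideal.map (algebraMap 𝓡.R (Localization.AtPrime η.asIdeal))
          (redIdeal (PseudoRep2.ofRep 𝓡.ρ))).IsPrincipal := by
  sorry

/-- **stub_cuspidalEisensteinCongruence (C3, THE LOAD-BEARING STUB: the cuspidal ordinary Hecke datum
and the codimension-two Eisenstein congruence at the generic point; size XL).**  For an SW-admissible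
oriented datum and a component `𝔮` through an irreducible prime `𝔭` which carries SOME Eisenstein divisor
with generic principality (the conclusion of `stub_eisensteinDivisor`, taken as an existential hypothesis;
the stub may re-choose the divisor `η ⊇ 𝔮`, minimal over `I`, `I·R_η` principal): there exist a weight
ring `Λ`, a
`P`-ordinary Hecke datum `H` for `GL₂/F` at `p` with bad set `𝒟.S` — intended: the REDUCED nearly
ordinary CUSPIDAL (interior) Hecke algebra of the Bianchi tower localised at the Eisenstein maximal ideal
`𝔪_{χ̄₁,χ̄₂}` over the 5-dimensional Iwasawa algebra `Λ_F = 𝒪⟦T₁,T₂,Y₁,Y₂⟧`, with its Chenevier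
determinant (Scholze / Caraiani–Newton on ordinary parts) — which is ATTACHED to a tame level `𝒰`
([ATT]: continuous `ι : 𝕋(𝒰) → T` matching Frobenius polynomials), ordinary at every `v ∣ p`
(`IsOrdinaryAbove`, `comp_toLocal` = ordinary local–global compatibility at `p`) with ORIENTED points
([ORP]), together with (i) a LOCAL homomorphism `θ : T → R_𝒟/η` carrying `D_T` to
`det ρ_𝒟 mod η` — the reducible family `Ψ₁ ⊕ Ψ₂` along the sheet IS a limit of cuspidal eigensystems:
the Eisenstein congruence exists generically along the sheet (for the sheet of an intersection
`C₁ ∈ 𝒞^mod ∩ C₂` it is free, triage r1-2; in general it is the two-variable analogue of Berger's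
theorem: `p`-adic `L`-value `L_p(Ψ₀) ∈ P`), with Hecke prime `P = ker θ` under `η`, and SURJECTIVE (`T` sees the whole sheet: `k(P) = k(η)`,
no pencil coordinate — this singles out the characteristic-0 sheets of unique extension class,
(C) `r(Ψ₀) = 1`; the characteristic-`p` pencil sheet present iff `r₀ = 2` is out of reach of this line);
(ii) CUSPIDALITY at `P`: `J·T_P` contains a NON-ZERO-DIVISOR and `length_{T_P} (T_P / J T_P) < ∞`,
`J = redIdeal D_T` the Eisenstein ideal — no Eisenstein component of `Spec T` passes through `P` (triage
r1-1: "x must be `T_η`-regular"; without the regular element the Eisenstein family `T = R/η`, `J = 0`,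
would satisfy everything else whenever the Selmer multiplicity is one); (iii) the DEPTH INEQUALITY
`length_{R_η}(R_η / I R_η) ≤ length_{T_P}(T_P / J T_P)` — Galois side = multiplicity of the fine Selmer
module `H` at the height-2 prime of `Λ₁` under `η` (intersection multiplicity of the two Katz divisors,
BCGKPST `c₂`), Hecke side = depth of the cuspidal Eisenstein congruences generically along the twist
family (Wiles/BK numerical-criterion shape; over `ℚ` at the closed point this is Berger–Klosin–Kramer
"`#T/J ≥ #𝒪/L`" from Berger's lower bound by `L^alg(0, χ)`).  Why it might fail: NO ordinary local–global
compatibility — oriented or not — is in print over an imaginary quadratic `F` even for non-Eisenstein `𝔪`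
(CaraianiNewton2023 Thm 4.2.15 hyp. (1), Rem. 1.3.1(2); ACC+ Thm 5.5.1 "[F⁺:ℚ] > 1"), so `H` with
`comp_toLocal`/[ORP] must come from an ascent to a solvable CM `F'` + descent (card
eisenstein-lgc-at-nice-prime) or a new theorem; the two-variable depth inequality has no printed template
(Berger2009 is one `L`-value, `p` split, `p ∤ h_F`, torsion-free `H²_c`); cuspidal Bianchi Hida families
are `Λ_F`-torsion so most points of `T` are non-classical and the congruences are between `p`-adic/torsion
eigensystems; at a characteristic-`p` sheet (present iff `r₀ = 2`) the statement is a mod-`ϖ` depth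
inequality along twists resting on the seed crux 12920.  v5 (lead reshape): the conclusion also EXPORTS an `𝒪`-algebra
structure on `H.T`, trace-density over `𝒪` (SW99 Lemma 3.11: `T` is topologically generated over `𝒪` by traces,
determinants and the ordinary characters) and `𝒪`-compatibility of `θ` — without them the next stub is refutable by
inert junk `T[y]/(yⁿ − a₀)` (see the module docstring).
[cite: SkinnerWiles1999, §3.2–3.3, Lemma 3.11 and §4.1] [cite: BergerKlosin2012, §5.2 and Thm. 49/Prop. 51 of arXiv:1103.5100 §7]
[cite: CaraianiNewton2023, Thm. 4.2.15 and Prop. 5.5.2] [cite: Scholze2015, Cor. V.4.3]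
[cite: Hida1993Duke] [cite: CalegariMazur2008, §1] (Berger, Compositio 145 (2009),
doi:10.1112/s0010437x09003984, Thm. 13; Bleher–Chinburg–Greenberg–Kakde–Pappas–Sharifi–Taylor
arXiv:1512.00273 §1.2) -/
theorem stub_cuspidalEisensteinCongruence : ∀ (F : Type) [Field F] [NumberField F] (p : ℕ)
    [Fact p.Prime] (𝒪 : Type) [CommRing 𝒪] [IsLocalRing 𝒪] [IsNoetherianRing 𝒪]
    [IsAdicComplete (maximalIdeal 𝒪) 𝒪] (k : Type) [Field k] [Finite k] [CharP k p] [Algebra 𝒪 k]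
    (𝒟 : NearlyOrdinaryDatum F p 𝒪 k) (𝓡 : NearlyOrdinaryDeformationRing.{0} 𝒟),
    (IsTotallyComplex F ∧ Module.finrank ℚ F = 2 ∧ p ≠ 2 ∧ IsDomain 𝒪 ∧ CharZero 𝒪 ∧
      𝒟.HasScalarCentralizer ∧
      (∀ v : HeightOneSpectrum (𝓞 F), (p : 𝓞 F) ∈ v.asIdeal → 𝒟.IsDistinguishedAt v) ∧
      (∀ γ, (𝒟.residual γ).val 1 0 = 0) ∧
      (∀ v : HeightOneSpectrum (𝓞 F), (p : 𝓞 F) ∈ v.asIdeal → (𝒟.frame v).val 1 0 ≠ 0)) →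
    ∀ (𝔭 : PrimeSpectrum 𝓡.R) (𝔮 : Ideal 𝓡.R), 𝔭 ∉ 𝓡.reducibleLocus → 𝔮 ∈ minimalPrimes 𝓡.R →
    𝔮 ≤ 𝔭.asIdeal →
    (∃ η₀ : PrimeSpectrum 𝓡.R, η₀ ∈ 𝓡.reducibleLocus ∧ 𝔮 ≤ η₀.asIdeal ∧
      η₀.asIdeal ∈ (redIdeal (PseudoRep2.ofRep 𝓡.ρ)).minimalPrimes ∧
      (Ideal.map (algebraMap 𝓡.R (Localization.AtPrime η₀.asIdeal))
        (redIdeal (PseudoRep2.ofRep 𝓡.ρ))).IsPrincipal) →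
    ∃ (Λ : Type) (_ : CommRing Λ) (_ : TopologicalSpace Λ) (H : POrdinaryHeckeAlgebraGL2 F p 𝒟.S Λ)
      (_ : Algebra 𝒪 H.T) (𝒰 : TameLevel 2 F p) (ι : CompletedCohomologyHeckeAlgebraGLn 𝒰 →+* H.T)
      (η : PrimeSpectrum 𝓡.R) (θ : H.T →+* 𝓡.R ⧸ η.asIdeal) (P : PrimeSpectrum H.T),
      η ∈ 𝓡.reducibleLocus ∧ 𝔮 ≤ η.asIdeal ∧
      η.asIdeal ∈ (redIdeal (PseudoRep2.ofRep 𝓡.ρ)).minimalPrimes ∧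
      (Ideal.map (algebraMap 𝓡.R (Localization.AtPrime η.asIdeal))
        (redIdeal (PseudoRep2.ofRep 𝓡.ρ))).IsPrincipal ∧
      (Continuous ι ∧ ∀ v ∉ 𝒰.bad, H.galoisRep.IsUnramifiedAt v ∧
      H.galoisRep.HasFrobCharpolyAt v
        (heckeFrobPoly 2 (Ideal.absNorm v.asIdeal) fun i => ι (𝒰.heckeT v i))) ∧
      H.IsOrdinaryAbove ∧
      (∀ (y : H.T →+* PadicAlgCl p), Continuous y →
      ∀ (ρ' : FramedGaloisRep F (PadicAlgCl p) 2)
        (ρ'₀ : absoluteGaloisGroup F →*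
          GL (Fin 2) ((Valued.v : Valuation (PadicAlgCl p) NNReal).valuationSubring)),
        (∀ g, ((ρ' g : GL (Fin 2) (PadicAlgCl p)) : Matrix (Fin 2) (Fin 2) (PadicAlgCl p)).trace =
          y (H.galoisRep.trace g)) →
        (∀ g, ((ρ' g : GL (Fin 2) (PadicAlgCl p)) : Matrix (Fin 2) (Fin 2) (PadicAlgCl p)).det =
          y (H.galoisRep.det g : H.T)) →
        ρ'.toGaloisRep.IsIrreducible → ρ'.HasUpperTriangularIntegralModel ρ'₀ →
        (∃ e : k →+* ResidueField ((Valued.v : Valuation (PadicAlgCl p) NNReal).valuationSubring),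
          ∀ g, residualDiag ρ'₀ 0 g = e ((𝒟.residual g).val 0 0)) →
        ∀ v : HeightOneSpectrum (𝓞 F), (p : 𝓞 F) ∈ v.asIdeal →
          ∃ Q : GL (Fin 2) (PadicAlgCl p), Valued.v (Q.val 0 0) ≤ Valued.v (Q.val 1 0) ∧
            ∀ σ, (Q⁻¹ * ρ'.toLocal v σ * Q).val 1 0 = 0) ∧
      Dense ((Algebra.adjoin 𝒪
        (Set.range H.galoisRep.trace ∪ Set.range (fun g => (H.galoisRep.det g : H.T)) ∪
          (⋃ v, Set.range fun σ => (H.ordChar₁ v σ : H.T)) ∪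
            ⋃ v, Set.range fun σ => (H.ordChar₂ v σ : H.T)) : Subalgebra 𝒪 H.T) : Set H.T) ∧
      (∀ o : 𝒪, θ (algebraMap 𝒪 H.T o) = Ideal.Quotient.mk η.asIdeal (algebraMap 𝒪 𝓡.R o)) ∧
      (maximalIdeal H.T).map θ ≤ (maximalIdeal 𝓡.R).map (Ideal.Quotient.mk η.asIdeal) ∧
      Function.Surjective θ ∧
      H.galoisRep.map θ = (PseudoRep2.ofRep 𝓡.ρ).map (Ideal.Quotient.mk η.asIdeal) ∧
      P.asIdeal = RingHom.ker θ ∧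
      (∃ t ∈ Ideal.map (algebraMap H.T (Localization.AtPrime P.asIdeal)) (redIdeal H.galoisRep),
        t ∈ nonZeroDivisors (Localization.AtPrime P.asIdeal)) ∧
      Module.length (Localization.AtPrime P.asIdeal)
          (Localization.AtPrime P.asIdeal ⧸
            Ideal.map (algebraMap H.T (Localization.AtPrime P.asIdeal)) (redIdeal H.galoisRep)) ≠ ⊤ ∧
      Module.length (Localization.AtPrime η.asIdeal)
          (Localization.AtPrime η.asIdeal ⧸
            Ideal.map (algebraMap 𝓡.R (Localization.AtPrime η.asIdeal))
              (redIdeal (PseudoRep2.ofRep 𝓡.ρ))) ≤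
        Module.length (Localization.AtPrime P.asIdeal)
          (Localization.AtPrime P.asIdeal ⧸
            Ideal.map (algebraMap H.T (Localization.AtPrime P.asIdeal)) (redIdeal H.galoisRep)) := by
  sorry

/-- **stub_rigidityAtGenericPoint ((P1_η): the numerical criterion at the generic Eisenstein point makes
the component pro-modular; size L).**  In the situation produced by the two previous stubs — `η` an
Eisenstein divisor on the component `𝔮` through the irreducible prime `𝔭`, `I·R_η = (x)` principal with
`(R/I)_η` Artinian, an attached oriented ordinary Hecke datum `H` with a local SURJECTIVE `θ : T → R/η`,
`P = ker θ`, a non-zero-divisor in `J·T_P`, `T_P/J T_P` of finite length `≥ length (R_η / x R_η)` — the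
minimal prime `𝔮` is locally pro-modular (local `ϑ : T → R/𝔮` carrying `D_T` to `det ρ_𝒟 mod 𝔮`).
Mechanism: (R1) the completion `R̂_η` of `R_η` pro-represents type-`𝒟` deformations of
`ρ_η = ρ_𝒟 ⊗ k(η)` (the generic reducible-but-indecomposable point, an extension of `Ψ₂` by `Ψ₁` over
`K = k(η)`) to Artinian local `K`-algebras (Kisin's argument at a non-closed point; STUB R1 shared with
card unibranch-eisenstein-sheets); the `T̂_P`-valued determinant with residual determinant `Ψ₁ ⊕ Ψ₂` and
CUSPIDALITY (irreducible on every component through `P`) yields, by Ribet's lattice over the normalisation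
and uniqueness of the extension class at `η` ((C): `r(Ψ₀) = 1`; else SW's transport of classes §4.3–4.4),
a type-`𝒟` deformation of `ρ_η` — near-ordinarity with the RIGHT line from `comp_toLocal` +
[ORP] —, hence `Φ : R̂_η → T̂_P`, surjective because `T` is topologically generated by
traces, determinants and `U`-operators (`dense_adjoin`); BC functoriality gives `Φ(x) T̂_P = J T̂_P`;
the Berger–Klosin criterion in regular-element form (triage r1-1 `bijective_of_regular_generator`,
kernel-checked: `(x) ≤ Jac`, `Φ(x)` `T̂_P`-regular — from finite length at a prime of the at-most
one-dimensional `T` —, `R̂_η/(x) ↪ T̂_P/(Φ x)` from the length inequality by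
`injective_of_surjective_of_length_le`) makes `Φ` an isomorphism; then, as in SW99 Prop. 8.4, the
relations of `T` die in `R̂_η ≅ T̂_P`, hence in `R_η ⊆ R̂_η` (Krull), hence modulo
`ker (R → R_η) ⊆ 𝔮`, which produces the local `θ_𝔮 : T → R/𝔮`.  Why it might fail: R1 at a point with
transcendental residue field `Frac 𝒪'⟦Y₁,Y₂⟧` is unproved; surjectivity of `θ` gives `k(P) = k(η)`
(no pencil coordinate) but if the extension class at `η` is nevertheless not unique, SW's transport of
classes along the sheet is needed before `Φ` exists; the
passage "iso of completions at `η` ⇒ `θ_𝔮`" uses that `T` is a quotient of the pseudo-deformation ring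
COMPATIBLY with `R` (continuity of `R^ps → R` versus the non-adic localisation `T → T_P`), i.e. the
trace-subalgebra bookkeeping of SW99 §5 (5.6)–(5.8).  v5 (lead reshape after the stub-worker's `stub-misstated`):
three hypotheses added — `[Algebra 𝒪 H.T]`, trace-density of `H.T` over `𝒪`, `𝒪`-compatibility of `θ` — which the
intended proof uses for the SURJECTIVITY of `Φ : R̂_η → T̂_P` and without which the statement is false (inert junk
`T[y]/(yⁿ − a₀)`, module docstring).  Still blocked on (R1) representability at the non-closed point `η`.
[cite: SkinnerWiles1999, §4.2 (P1), Lemma 3.11, §5 (5.6)–(5.8) and Prop. 8.4] [cite: BergerKlosin2012, §5.2]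
(Berger–Klosin, arXiv:1103.5100 §7 Thm. 49 / Prop. 51; Kisin, Invent. 153 (2003) §9) -/
theorem stub_rigidityAtGenericPoint : ∀ (F : Type) [Field F] [NumberField F] (p : ℕ)
    [Fact p.Prime] (𝒪 : Type) [CommRing 𝒪] [IsLocalRing 𝒪] [IsNoetherianRing 𝒪]
    [IsAdicComplete (maximalIdeal 𝒪) 𝒪] (k : Type) [Field k] [Finite k] [CharP k p] [Algebra 𝒪 k]
    (𝒟 : NearlyOrdinaryDatum F p 𝒪 k) (𝓡 : NearlyOrdinaryDeformationRing.{0} 𝒟),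
    (IsTotallyComplex F ∧ Module.finrank ℚ F = 2 ∧ p ≠ 2 ∧ IsDomain 𝒪 ∧ CharZero 𝒪 ∧
      𝒟.HasScalarCentralizer ∧
      (∀ v : HeightOneSpectrum (𝓞 F), (p : 𝓞 F) ∈ v.asIdeal → 𝒟.IsDistinguishedAt v) ∧
      (∀ γ, (𝒟.residual γ).val 1 0 = 0) ∧
      (∀ v : HeightOneSpectrum (𝓞 F), (p : 𝓞 F) ∈ v.asIdeal → (𝒟.frame v).val 1 0 ≠ 0)) →
    ∀ (𝔭 η : PrimeSpectrum 𝓡.R) (𝔮 : Ideal 𝓡.R), 𝔭 ∉ 𝓡.reducibleLocus → 𝔮 ∈ minimalPrimes 𝓡.R →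
    𝔮 ≤ 𝔭.asIdeal → η ∈ 𝓡.reducibleLocus → 𝔮 ≤ η.asIdeal →
    η.asIdeal ∈ (redIdeal (PseudoRep2.ofRep 𝓡.ρ)).minimalPrimes →
    (Ideal.map (algebraMap 𝓡.R (Localization.AtPrime η.asIdeal))
      (redIdeal (PseudoRep2.ofRep 𝓡.ρ))).IsPrincipal →
    ∀ (Λ : Type) [CommRing Λ] [TopologicalSpace Λ] (H : POrdinaryHeckeAlgebraGL2 F p 𝒟.S Λ)
      [Algebra 𝒪 H.T] (𝒰 : TameLevel 2 F p) (ι : CompletedCohomologyHeckeAlgebraGLn 𝒰 →+* H.T)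
      (θ : H.T →+* 𝓡.R ⧸ η.asIdeal) (P : PrimeSpectrum H.T),
    (Continuous ι ∧ ∀ v ∉ 𝒰.bad, H.galoisRep.IsUnramifiedAt v ∧
      H.galoisRep.HasFrobCharpolyAt v
        (heckeFrobPoly 2 (Ideal.absNorm v.asIdeal) fun i => ι (𝒰.heckeT v i))) →
    H.IsOrdinaryAbove →
    (∀ (y : H.T →+* PadicAlgCl p), Continuous y →
      ∀ (ρ' : FramedGaloisRep F (PadicAlgCl p) 2)
        (ρ'₀ : absoluteGaloisGroup F →*
          GL (Fin 2) ((Valued.v : Valuation (PadicAlgCl p) NNReal).valuationSubring)),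
        (∀ g, ((ρ' g : GL (Fin 2) (PadicAlgCl p)) : Matrix (Fin 2) (Fin 2) (PadicAlgCl p)).trace =
          y (H.galoisRep.trace g)) →
        (∀ g, ((ρ' g : GL (Fin 2) (PadicAlgCl p)) : Matrix (Fin 2) (Fin 2) (PadicAlgCl p)).det =
          y (H.galoisRep.det g : H.T)) →
        ρ'.toGaloisRep.IsIrreducible → ρ'.HasUpperTriangularIntegralModel ρ'₀ →
        (∃ e : k →+* ResidueField ((Valued.v : Valuation (PadicAlgCl p) NNReal).valuationSubring),
          ∀ g, residualDiag ρ'₀ 0 g = e ((𝒟.residual g).val 0 0)) →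
        ∀ v : HeightOneSpectrum (𝓞 F), (p : 𝓞 F) ∈ v.asIdeal →
          ∃ Q : GL (Fin 2) (PadicAlgCl p), Valued.v (Q.val 0 0) ≤ Valued.v (Q.val 1 0) ∧
            ∀ σ, (Q⁻¹ * ρ'.toLocal v σ * Q).val 1 0 = 0) →
    Dense ((Algebra.adjoin 𝒪
      (Set.range H.galoisRep.trace ∪ Set.range (fun g => (H.galoisRep.det g : H.T)) ∪
        (⋃ v, Set.range fun σ => (H.ordChar₁ v σ : H.T)) ∪
          ⋃ v, Set.range fun σ => (H.ordChar₂ v σ : H.T)) : Subalgebra 𝒪 H.T) : Set H.T) →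
    (∀ o : 𝒪, θ (algebraMap 𝒪 H.T o) = Ideal.Quotient.mk η.asIdeal (algebraMap 𝒪 𝓡.R o)) →
    (maximalIdeal H.T).map θ ≤ (maximalIdeal 𝓡.R).map (Ideal.Quotient.mk η.asIdeal) →
    Function.Surjective θ →
    H.galoisRep.map θ = (PseudoRep2.ofRep 𝓡.ρ).map (Ideal.Quotient.mk η.asIdeal) →
    P.asIdeal = RingHom.ker θ →
    (∃ t ∈ Ideal.map (algebraMap H.T (Localization.AtPrime P.asIdeal)) (redIdeal H.galoisRep),
      t ∈ nonZeroDivisors (Localization.AtPrime P.asIdeal)) →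
    Module.length (Localization.AtPrime P.asIdeal)
        (Localization.AtPrime P.asIdeal ⧸
          Ideal.map (algebraMap H.T (Localization.AtPrime P.asIdeal)) (redIdeal H.galoisRep)) ≠ ⊤ →
    Module.length (Localization.AtPrime η.asIdeal)
        (Localization.AtPrime η.asIdeal ⧸
          Ideal.map (algebraMap 𝓡.R (Localization.AtPrime η.asIdeal))
            (redIdeal (PseudoRep2.ofRep 𝓡.ρ))) ≤
      Module.length (Localization.AtPrime P.asIdeal)
        (Localization.AtPrime P.asIdeal ⧸
          Ideal.map (algebraMap H.T (Localization.AtPrime P.asIdeal)) (redIdeal H.galoisRep)) →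
    (∃ ϑ : H.T →+* 𝓡.R ⧸ 𝔮,
      (maximalIdeal H.T).map ϑ ≤ (maximalIdeal 𝓡.R).map (Ideal.Quotient.mk (𝔮)) ∧
        H.galoisRep.map ϑ = (PseudoRep2.ofRep 𝓡.ρ).map (Ideal.Quotient.mk (𝔮))) := by
  sorry

/-- `heckeFrobPoly` is compatible with ring homomorphisms (coefficientwise). [folklore] -/
theorem heckeFrobPoly_map {A B : Type*} [CommRing A] [CommRing B] (g : A →+* B) (n q : ℕ)
    (a : ℕ → A) :
    (heckeFrobPoly n q a).map g = heckeFrobPoly n q (fun i => g (a i)) := by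
  simp [heckeFrobPoly, Polynomial.map_sum]

/-- The characteristic polynomial `X² − T X + D` of a two-dimensional determinant is compatible with
change of coefficients. [folklore] -/
theorem PseudoRep2.charpoly_map' {G A B : Type*} [Group G] [CommRing A] [CommRing B]
    (D : PseudoRep2 G A) (g : A →+* B) (x : G) :
    (D.map g).charpoly x = (D.charpoly x).map g := by
  simp [PseudoRep2.charpoly, Polynomial.map_sub, Polynomial.map_add, Polynomial.map_mul]

/-- **heckeExit — the EXIT, PROVED here (pro-modular ⇒ `p`-adically automorphic); it was the fifth stub of
the first draft and is now a kernel-checked lemma of the line, so the skeleton registers FOUR stubs.**  If `H` is attached to the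
tame level `𝒰` through `ι`, the prime `ker f` of `R_𝒟` is locally pro-modular for `H` (in the composition:
from the component `𝔮 ⊆ ker f` by `isLocallyProModular_of_le`, SW99 §4.1), `f : R_𝒟 → ℚ̄_p` is integral
and local, `ρ` is `GL₂(ℚ̄_p)`-conjugate to `f ∘ ρ_𝒟` and unramified almost everywhere, then `ρ` is
`p`-adically automorphic of SOME tame level `𝒰'`.  Mechanism:
`θ : T → R/ker f ↪ ℚ̄_p` gives a ring homomorphism `y : T → ℚ̄_p` with
`y ∘ D_T = (tr ρ, det ρ)`; `y` is CONTINUOUS because `θ` is local and `f` integral-local (`𝔪_R` finitely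
generated ⇒ `‖f(𝔪_R^n)‖ ≤ c^n`, `c < 1`; `T` carries the `𝔪_T`-adic topology, `H.isAdic`), so
`x = y ∘ ι : 𝕋(𝒰) → ℚ̄_p` is a continuous point; at `v ∉ 𝒰.bad ∪ Ram(ρ)` the arithmetic Frobenius
polynomial of `ρ` is `X² − tr X + det = y(D_T.charpoly Frob_v) = x(P_v)` by [ATT]; the finitely
many ramified places of `ρ` (`hunr` — the crux hypothesis the Disproof shows NECESSARY) are absorbed into
the bad set: `𝒰' := enlargeBad 𝒰 (𝒰.bad ∪ Ram ρ)` as in the landed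
`Negative.exists_isPadicallyAutomorphic_bad_eq` (never `TameLevel.full`, cf.
`Negative.not_isPadicallyAutomorphic_full`); its Hecke algebra is the closed subring of `𝕋(𝒰)` on fewer
generators and the point is restricted along the (continuous) inclusion.  Proof below: ~150 lines, no
`sorry`; Mathlib `IsAdic.hasBasis_nhds_zero`, `Submodule.span_induction`/`smul_induction_on` for the
bound `‖f(𝔪_R^n)‖ ≤ c^n`, `Matrix.charpoly_units_conj`, `Matrix.charpoly_map`, `PseudoRep2.charpoly_ofRep`.
[cite: SkinnerWiles1999, §4.1] [cite: GeeNewton2020, §3.3 Def. 3.3.4]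
[cite: HansenUniversalEigenvarieties2017, Def. 1.2.1] -/
theorem heckeExit : ∀ (F : Type) [Field F] [NumberField F] (p : ℕ) [Fact p.Prime]
    (𝒪 : Type) [CommRing 𝒪] [IsLocalRing 𝒪] [IsNoetherianRing 𝒪] [IsAdicComplete (maximalIdeal 𝒪) 𝒪]
    (k : Type) [Field k] [Finite k] [CharP k p] [Algebra 𝒪 k]
    (𝒟 : NearlyOrdinaryDatum F p 𝒪 k) (𝓡 : NearlyOrdinaryDeformationRing.{0} 𝒟)
    (S : Set (HeightOneSpectrum (𝓞 F))) (Λ : Type) [CommRing Λ] [TopologicalSpace Λ]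
    (H : POrdinaryHeckeAlgebraGL2 F p S Λ) (𝒰 : TameLevel 2 F p)
    (ι : CompletedCohomologyHeckeAlgebraGLn 𝒰 →+* H.T),
    (Continuous ι ∧ ∀ v ∉ 𝒰.bad, H.galoisRep.IsUnramifiedAt v ∧
      H.galoisRep.HasFrobCharpolyAt v
        (heckeFrobPoly 2 (Ideal.absNorm v.asIdeal) fun i => ι (𝒰.heckeT v i))) →
    ∀ (f : 𝓡.R →+* PadicAlgCl p),
    (∃ ϑ : H.T →+* 𝓡.R ⧸ RingHom.ker f,
      (maximalIdeal H.T).map ϑ ≤ (maximalIdeal 𝓡.R).map (Ideal.Quotient.mk (RingHom.ker f)) ∧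
        H.galoisRep.map ϑ = (PseudoRep2.ofRep 𝓡.ρ).map (Ideal.Quotient.mk (RingHom.ker f))) →
    (∀ r, Valued.v (f r) ≤ 1) → (∀ r ∈ maximalIdeal 𝓡.R, Valued.v (f r) < 1) →
    ∀ (ρ : FramedGaloisRep F (PadicAlgCl p) 2) (P : GL (Fin 2) (PadicAlgCl p)),
    (∀ γ, ρ γ = P * Matrix.GeneralLinearGroup.map f (𝓡.ρ γ) * P⁻¹) →
    (∀ᶠ v in cofinite, ρ.IsUnramifiedAt v) →
    ∃ 𝒰' : TameLevel 2 F p, 𝒰'.IsPadicallyAutomorphic ρ := by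
  intro F _ _ p _ 𝒪 _ _ _ _ k _ _ _ _ 𝒟 𝓡 S Λ _ _ H 𝒰 ι hatt f hpro hint hlocf ρ P hconj hunr
  obtain ⟨hιcont, hass⟩ := hatt
  obtain ⟨ϑ, hϑloc, hϑD⟩ := hpro
  -- the point `y : T → ℚ̄_p`
  let fbar : 𝓡.R ⧸ RingHom.ker f →+* PadicAlgCl p := RingHom.kerLift f
  let y : H.T →+* PadicAlgCl p := fbar.comp ϑ
  have hfbar : fbar.comp (Ideal.Quotient.mk (RingHom.ker f)) = f :=
    RingHom.ext fun r => RingHom.kerLift_mk f r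
  -- (1) continuity of `y`
  have hycont : Continuous y := by
    obtain ⟨Sfin, hS⟩ := (IsNoetherian.noetherian (maximalIdeal 𝓡.R) : (maximalIdeal 𝓡.R).FG)
    set c : ℝ≥0 := Sfin.sup fun s => Valued.v (f s) with hc
    have hc1 : c < 1 := by
      refine (Finset.sup_lt_iff (bot_lt_iff_ne_bot.mpr one_ne_zero)).mpr ?_
      intro s hs
      exact hlocf s (hS ▸ Submodule.subset_span hs)
    have hm1 : ∀ r ∈ maximalIdeal 𝓡.R, Valued.v (f r) ≤ c := by
      intro r hr
      rw [← hS] at hr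
      induction hr using Submodule.span_induction with
      | mem x hx => exact Finset.le_sup (f := fun s => Valued.v (f s)) hx
      | zero => simp
      | add x x' _ _ hx hx' =>
        rw [map_add]
        exact (Valuation.map_add _ _ _).trans (max_le hx hx')
      | smul a x _ hx =>
        rw [smul_eq_mul, map_mul, Valuation.map_mul]
        calc Valued.v (f a) * Valued.v (f x) ≤ 1 * c := mul_le_mul' (hint a) hx
          _ = c := one_mul c
    have hmn : ∀ n : ℕ, ∀ r ∈ maximalIdeal 𝓡.R ^ n, Valued.v (f r) ≤ c ^ n := by
      intro n
      induction n with
      | zero =>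
        intro r _
        simpa using hint r
      | succ n ih =>
        intro r hr
        rw [pow_succ] at hr
        refine Submodule.smul_induction_on hr ?_ ?_
        · intro m hm n' hn'
          rw [smul_eq_mul, map_mul, Valuation.map_mul, pow_succ]
          exact mul_le_mul' (ih m hm) (hm1 n' hn')
        · intro x x' hx hx'
          rw [map_add]
          exact (Valuation.map_add _ _ _).trans (max_le hx hx')
    have hyn : ∀ n : ℕ, ∀ t ∈ maximalIdeal H.T ^ n, Valued.v (y t) ≤ c ^ n := by
      intro n t ht
      have h1 : ϑ t ∈ (maximalIdeal H.T ^ n).map ϑ := Ideal.mem_map_of_mem _ ht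
      have h2 : (maximalIdeal H.T ^ n).map ϑ ≤
          (maximalIdeal 𝓡.R ^ n).map (Ideal.Quotient.mk (RingHom.ker f)) := by
        rw [Ideal.map_pow, Ideal.map_pow]
        exact Ideal.pow_right_mono hϑloc n
      obtain ⟨r, hr, hrt⟩ :=
        (Ideal.mem_map_iff_of_surjective _ Ideal.Quotient.mk_surjective).mp (h2 h1)
      have hyt : y t = f r := by
        change fbar (ϑ t) = f r
        rw [← hrt]
        exact RingHom.kerLift_mk f r
      rw [hyt]
      exact hmn n r hr
    apply continuous_of_continuousAt_zero y
    rw [ContinuousAt, map_zero, (H.isAdic.hasBasis_nhds_zero).tendsto_iff Metric.nhds_basis_ball]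
    intro ε hε
    obtain ⟨n, hn⟩ := exists_pow_lt_of_lt_one hε (show ((c : ℝ≥0) : ℝ) < 1 by exact_mod_cast hc1)
    refine ⟨n, trivial, fun t ht => ?_⟩
    rw [Metric.mem_ball, dist_zero_right]
    calc ‖y t‖ = ((Valued.v (y t) : ℝ≥0) : ℝ) := rfl
      _ ≤ ((c ^ n : ℝ≥0) : ℝ) := by exact_mod_cast hyn n t ht
      _ = (c : ℝ) ^ n := by push_cast; rfl
      _ < ε := hn
  -- (2) the determinant identity `D_T ⊗_y ℚ̄_p = det (f ∘ ρ_𝒟)`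
  have hDy : H.galoisRep.map y = (PseudoRep2.ofRep 𝓡.ρ).map f := by
    change H.galoisRep.map (fbar.comp ϑ) = _
    rw [← PseudoRep2.map_map, hϑD, PseudoRep2.map_map, hfbar]
  -- (3) the enlarged level
  have hfin : {v : HeightOneSpectrum (𝓞 F) | ¬ ρ.IsUnramifiedAt v}.Finite := by
    rwa [Filter.eventually_cofinite] at hunr
  let 𝒰' : TameLevel 2 F p :=
    { subgroup := 𝒰.subgroup
      bad := 𝒰.bad ∪ {v | ¬ ρ.IsUnramifiedAt v}
      bad_finite := 𝒰.bad_finite.union hfin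
      mem_bad_of_mem := fun v hv => Or.inl (𝒰.mem_bad_of_mem v hv)
      isOpen := 𝒰.isOpen
      isCompact := 𝒰.isCompact
      le_glFiniteIntegralLevel := 𝒰.le_glFiniteIntegralLevel
      ofLocal_mem := fun v hv g hg => 𝒰.ofLocal_mem v (fun h => hv (Or.inl h)) g hg
      mul_ofLocal_inv_mem := fun v hv u hu =>
        𝒰.mul_ofLocal_inv_mem v (fun h => hv (Or.inl h)) u hu }
  refine ⟨𝒰', ?_⟩
  have hgen : 𝒰'.heckeGenerators ⊆ 𝒰.heckeGenerators := by
    rintro z (⟨v, hv, i, rfl⟩ | ⟨v, hv, rfl⟩)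
    · exact Or.inl ⟨v, fun h => hv (Or.inl h), i, rfl⟩
    · exact Or.inr ⟨v, fun h => hv (Or.inl h), rfl⟩
  have hsub : 𝒰'.bigHeckeSubring ≤ 𝒰.bigHeckeSubring :=
    Subring.topologicalClosure_mono (Subring.closure_mono hgen)
  have hcont : Continuous (Subring.inclusion hsub) := by
    refine continuous_induced_rng.2 ?_
    have hval : Continuous (Subtype.val : 𝒰'.bigHeckeSubring → 𝒰'.bigEnd) :=
      continuous_subtype_val
    convert hval using 1
    funext z
    exact Subring.coe_inclusion hsub z
  refine ⟨(y.comp ι).comp (Subring.inclusion hsub), (hycont.comp hιcont).comp hcont,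
    fun v hv => ?_⟩
  have hvb : v ∉ 𝒰.bad := fun h => hv (Or.inl h)
  have hvunr : ρ.IsUnramifiedAt v := by
    by_contra h
    exact hv (Or.inr h)
  refine ⟨hvunr, ?_⟩
  intro 𝔓 h𝔓 σ hσ
  obtain ⟨-, hchar⟩ := hass v hvb
  have h1 : H.galoisRep.charpoly σ =
      heckeFrobPoly 2 (Ideal.absNorm v.asIdeal) (fun i => ι (𝒰.heckeT v i)) := hchar 𝔓 h𝔓 σ hσ
  have key : ∀ i, (Subring.inclusion hsub (𝒰'.heckeT v i)) = 𝒰.heckeT v i := by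
    intro i
    apply Subtype.ext
    rw [Subring.coe_inclusion, 𝒰'.coe_heckeT hv i, 𝒰.coe_heckeT hvb i]
    rfl
  -- charpoly of `ρ σ`
  have hmat : ((Matrix.GeneralLinearGroup.map f (𝓡.ρ σ) : GL (Fin 2) (PadicAlgCl p)) :
      Matrix (Fin 2) (Fin 2) (PadicAlgCl p)) =
      ((𝓡.ρ σ : GL (Fin 2) 𝓡.R) : Matrix (Fin 2) (Fin 2) 𝓡.R).map f := by
    ext i j
    exact Matrix.GeneralLinearGroup.map_apply f i j (𝓡.ρ σ)
  have hρσ : FramedRep.charpoly ρ σ = ((PseudoRep2.ofRep 𝓡.ρ).charpoly σ).map f := by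
    rw [FramedRep.charpoly, hconj σ, Units.val_mul, Units.val_mul, Matrix.coe_units_inv,
      Matrix.charpoly_units_conj, hmat, Matrix.charpoly_map, PseudoRep2.charpoly_ofRep]
  calc FramedRep.charpoly ρ σ
      = ((PseudoRep2.ofRep 𝓡.ρ).charpoly σ).map f := hρσ
    _ = ((PseudoRep2.ofRep 𝓡.ρ).map f).charpoly σ := (PseudoRep2.charpoly_map' _ _ _).symm
    _ = (H.galoisRep.map y).charpoly σ := by rw [hDy]
    _ = (H.galoisRep.charpoly σ).map y := PseudoRep2.charpoly_map' _ _ _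
    _ = heckeFrobPoly 2 (Ideal.absNorm v.asIdeal) (fun i => y (ι (𝒰.heckeT v i))) := by
        rw [h1, heckeFrobPoly_map]
    _ = heckeFrobPoly 2 (Ideal.absNorm v.asIdeal)
          (fun i => ((y.comp ι).comp (Subring.inclusion hsub)) (𝒰'.heckeT v i)) := by
        congr 1
        funext i
        simp only [RingHom.comp_apply]
        exact congrArg (fun z => y (ι z)) (key i).symm

/-! ## Helper sub-goals of wave 1 (registered in v6) — ALL LANDED (v8): `redIdeal_le` in `…GenericEisensteinDefs` (p106218),
`stub_rigidityAtGenericPoint_auxCriterion` in `…RigidityCriterionAux` (p105711), `stub_eisensteinDivisor_auxRedIdealSpan` in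
`…GenericEisensteinRedIdealAux` (p111272) — these three files are imported above —, and `stub_eisensteinDivisor_auxReducibleLocus` +
`stub_eisensteinDivisor_of_isPrincipal_of_dim` in `…GenericEisensteinReducibleLocusAux` (p112399, accepted; import it here once the farm has
built it).  None is used by the composition; their sorried registration copies are removed.  What they give the line: `Z^red = V(redIdeal)` for
the interface ring and S2 ⇐ (F1) ∧ (F2) ∧ (F3); the numerical criterion core for S4. -/



/-! ## The composition: the four stubs and the proved exit imply the crux BY NAME -/

/-- **Composition (the skeleton theorem).**  Uses the four registered stubs BY NAME, the proved
`isLocallyProModular_of_le` and `heckeExit`, and nothing else: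
set-up (`ρ ↦ 𝔭 ∈ Spec R_𝒟`) → an Eisenstein divisor `η ⊇ 𝔮 ⊆ 𝔭` with generic principality → the
cuspidal Hecke datum and the congruence inequality at `η` → rigidity: `𝔮` locally pro-modular → exit at
`𝔭 = ker f ⊇ 𝔮` with enlarged bad set.  Pure logic over the stub signatures. -/
theorem ReducibleOrdinaryProModular_of : ReducibleOrdinaryProModular := by
  intro F _ _ hF hdeg p _ hp O hO ρ ρ₀ hirr hunr hmod hloc
  -- (1) Skinner–Wiles set-up: `ρ` is the irreducible prime `𝔭 = ker f` of `R_𝒟`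
  obtain ⟨𝒪, _, _, _, _, k, _, _, _, _, 𝒟, 𝓡, 𝔭, f, Pm, hSW, hker, hirred, hint, hlocf, hconj⟩ :=
    stub_typeDSetup F hF hdeg p hp O hO ρ ρ₀ hirr hunr hmod hloc
  -- (2) an Eisenstein divisor `η` on a component `𝔮 ⊆ 𝔭`, with `I·R_η` principal
  obtain ⟨𝔮, h𝔮min, h𝔮𝔭, η₀, hη₀red, h𝔮η₀, hη₀min, hprinc₀⟩ :=
    stub_eisensteinDivisor F p 𝒪 k 𝒟 𝓡 hSW 𝔭 hirred
  -- (3) the cuspidal Hecke datum at an Eisenstein divisor `η` of the same component (the stub may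
  --     re-choose the divisor), the generic Eisenstein congruence `θ` and the depth inequality
  obtain ⟨Λ, _, _, H, _, 𝒰, ι, η, θ, P, hηred, h𝔮η, hηmin, hprinc, hatt, hord, hpts, hdense, hθ𝒪, hθloc,
      hθsurj, hθD, hP, hreg, hfin, hle⟩ :=
    stub_cuspidalEisensteinCongruence F p 𝒪 k 𝒟 𝓡 hSW 𝔭 𝔮 hirred h𝔮min h𝔮𝔭
      ⟨η₀, hη₀red, h𝔮η₀, hη₀min, hprinc₀⟩
  -- (4) rigidity at the generic point: the component `𝔮` is locally pro-modular
  have hpro :=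
    stub_rigidityAtGenericPoint F p 𝒪 k 𝒟 𝓡 hSW 𝔭 η 𝔮 hirred h𝔮min h𝔮𝔭 hηred h𝔮η hηmin hprinc
      Λ H 𝒰 ι θ P hatt hord hpts hdense hθ𝒪 hθloc hθsurj hθD hP hreg hfin hle
  -- (5) pro-modularity ascends to `𝔭 = ker f ⊇ 𝔮` (SW99 §4.1); exit with enlarged bad set
  have h𝔮f : 𝔮 ≤ RingHom.ker f := by
    rw [hker]
    exact h𝔮𝔭
  exact heckeExit F p 𝒪 k 𝒟 𝓡 𝒟.S Λ H 𝒰 ι hatt f (isLocallyProModular_of_le H 𝓡 hpro h𝔮f) hint hlocf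
    ρ Pm hconj hunr

end

end Summit.Langlands.Langlands.Cruxes.ReducibleOrdinaryProModular.GenericEisensteinRigidity
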